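import Summits.QuantumFields.YangMills.Theorems.IR.LevelwiseDominationTower
import Mathlib.Combinatorics.Hall.Basic
import HarnessLib

/-!
# Crux `IRcof` (stmt-QuantumFields-26930) — supplier line «lipschitz-vacuum-transport», part 4: the COUNTING (density-of-states) content of
# a level matching — bridge to the typed DOS clause of the sibling supplier line «no-halving-octave»

Helper module for `Summit.QuantumFields.YangMills.Theses.BalabanLadder.IRcof` (`--supports stmt-QuantumFields-26930`; closes nothing), crux LEAD
ymfull-r2c-lead-1 g1.  A level matching `LevelMatched rr d m c L` (injective domination of the ratio levels `rr` by the free tower of mass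
`m > 0`) forces, for every energy `E ≥ 0`, the number of levels `rr i ≥ e^{−E}` in any finite family to be at most the number of free
occupation configurations of energy `≤ E`, hence at most `(E/m + 1)^{d·L³}` (`card_le_freeCount_of_levelMatched`, `card_le_pow_of_levelMatched`).
This is exactly the SHAPE in which the critic typed the density-of-states hypothesis of the line «no-halving-octave» (crit-1 CUT-3(A2) ‼1′:
«`∀ F : Finset ι, (∀ i ∈ F, Real.exp (-E) ≤ rr i) → (F.card : ℝ) ≤ bound`» over the built ratio idiom `IsRatioDatum`), so the two supplier
lines of the slot `pinned_cofinal_bill` meet in one currency: LW-DOM's counting content is a DOS bound EXPONENTIAL in the volume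
(`(E/m+1)^{d L³}`), the no-halving conversion wants one POLYNOMIAL in `L` — the gap between the two is typed, not bridged, here.

HONEST FRAMING: elementary finite combinatorics about the line's vocabulary; nothing here proves `LevelwiseDominatedCofinal`,
`PinnedExitsCofinalAt (1/24)`, `IRnscCof`, `IRcof`, `IR`, any leg, or the Yang–Mills mass gap (Clay) — NOT proved; NOT continuum ∕ OS.
-/

set_option autoImplicit false

noncomputable section

open Filter Topology MeasureTheory
open scoped BigOperators

namespace Summit.QuantumFields.YangMills.Cruxes.IR.LevelwiseDomination

/-- The finite set of free occupation configurations with every occupation number `≤ n`. -/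
def occBox (d L n : ℕ) : Finset (Fin d × (Fin 3 → Fin L) → ℕ) :=
  Fintype.piFinset fun _ => Finset.range (n + 1)

/-- `card (occBox d L n) = (n+1)^{d·L³}`. -/
theorem card_occBox (d L n : ℕ) : (occBox d L n).card = (n + 1) ^ (d * L ^ 3) := by
  classical
  unfold occBox
  rw [Fintype.card_piFinset, Finset.prod_const, Finset.card_range, Finset.card_univ]
  congr 1
  simp [Fintype.card_prod, Fintype.card_fin, Fintype.card_pi]

/-- **Free count.** The finite set of free occupation configurations of energy `≤ E` (mass `m > 0` makes it finite: every occupation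
number is `≤ ⌊E/m⌋`). -/
def freeCount (d : ℕ) (m c : ℝ) (L : ℕ) (E : ℝ) : Finset (Fin d × (Fin 3 → Fin L) → ℕ) :=
  (occBox d L ⌊E / m⌋₊).filter fun g => occupationEnergy d m c L g ≤ E

/-- A configuration of energy `≤ E` has every occupation number `≤ ⌊E/m⌋`. -/
theorem apply_le_floor_of_occupationEnergy_le (d : ℕ) {m : ℝ} (hm : 0 < m) (c : ℝ) (L : ℕ)
    {g : Fin d × (Fin 3 → Fin L) → ℕ} {E : ℝ} (hg : occupationEnergy d m c L g ≤ E) (p : Fin d × (Fin 3 → Fin L)) :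
    g p ≤ ⌊E / m⌋₊ := by
  have hterm : ∀ q, 0 ≤ (g q : ℝ) * latticeDispersion m c L q.2 :=
    fun q => mul_nonneg (Nat.cast_nonneg _) (hm.le.trans (mass_le_latticeDispersion hm.le c L q.2))
  have h1 : (g p : ℝ) * latticeDispersion m c L p.2 ≤ occupationEnergy d m c L g := by
    unfold occupationEnergy
    exact Finset.single_le_sum (f := fun q => (g q : ℝ) * latticeDispersion m c L q.2) (fun q _ => hterm q) (Finset.mem_univ p)
  have h2 : (g p : ℝ) * m ≤ (g p : ℝ) * latticeDispersion m c L p.2 :=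
    mul_le_mul_of_nonneg_left (mass_le_latticeDispersion hm.le c L p.2) (Nat.cast_nonneg _)
  have h3 : (g p : ℝ) ≤ E / m := by
    rw [le_div_iff₀ hm]
    linarith
  exact Nat.le_floor h3

/-- Membership in the free count. -/
theorem mem_freeCount (d : ℕ) {m : ℝ} (hm : 0 < m) (c : ℝ) (L : ℕ) {g : Fin d × (Fin 3 → Fin L) → ℕ} {E : ℝ}
    (hg : occupationEnergy d m c L g ≤ E) : g ∈ freeCount d m c L E := by
  unfold freeCount occBox
  rw [Finset.mem_filter, Fintype.mem_piFinset]
  exact ⟨fun p => Finset.mem_range.2 (Nat.lt_succ_of_le (apply_le_floor_of_occupationEnergy_le d hm c L hg p)), hg⟩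

/-- `card (freeCount) ≤ (⌊E/m⌋+1)^{d·L³}`. -/
theorem card_freeCount_le (d : ℕ) (m c : ℝ) (L : ℕ) (E : ℝ) :
    (freeCount d m c L E).card ≤ (⌊E / m⌋₊ + 1) ^ (d * L ^ 3) := by
  unfold freeCount
  exact (Finset.card_filter_le _ _).trans (card_occBox d L _).le

/-- **Counting content of a level matching (exact free count).**  If the ratio levels `rr` are level-matched into the free tower of
mass `m > 0`, then every finite family of levels `rr i ≥ e^{−E}` has at most `#{g : occupationEnergy g ≤ E}` members. -/
theorem card_le_freeCount_of_levelMatched {ι : Type} {rr : ι → ℝ} {d : ℕ} {m c : ℝ} {L : ℕ} (hm : 0 < m)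
    (h : LevelMatched rr d m c L) (E : ℝ) (F : Finset ι) (hF : ∀ i ∈ F, Real.exp (-E) ≤ rr i) :
    F.card ≤ (freeCount d m c L E).card := by
  classical
  obtain ⟨f, hinj, hle⟩ := h
  have hpos : ∀ i ∈ F, rr i ≠ 0 := fun i hi => (lt_of_lt_of_le (Real.exp_pos _) (hF i hi)).ne'
  have hE : ∀ i ∈ F, occupationEnergy d m c L (f i) ≤ E := by
    intro i hi
    have h1 : Real.exp (-E) ≤ Real.exp (-(occupationEnergy d m c L (f i))) := (hF i hi).trans (hle i)
    have h2 := Real.exp_le_exp.1 h1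
    linarith
  calc F.card = (F.image f).card := (Finset.card_image_of_injOn fun i hi j hj hij => hinj (hpos i hi) (hpos j hj) hij).symm
    _ ≤ (freeCount d m c L E).card :=
        Finset.card_le_card fun g hg => by
          obtain ⟨i, hi, rfl⟩ := Finset.mem_image.1 hg
          exact mem_freeCount d hm c L (hE i hi)

/-- **Counting content of a level matching (closed form).**  Under `LevelMatched rr d m c L` with `m > 0`, for every `E ≥ 0` and every
finite family `F` of levels with `e^{−E} ≤ rr i`:  `card F ≤ (E/m + 1)^{d·L³}` — the critic-typed DOS shape, with a bound exponential in the
volume. -/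
theorem card_le_pow_of_levelMatched {ι : Type} {rr : ι → ℝ} {d : ℕ} {m c : ℝ} {L : ℕ} (hm : 0 < m)
    (h : LevelMatched rr d m c L) {E : ℝ} (hE : 0 ≤ E) (F : Finset ι) (hF : ∀ i ∈ F, Real.exp (-E) ≤ rr i) :
    (F.card : ℝ) ≤ (E / m + 1) ^ (d * L ^ 3) := by
  have h1 : F.card ≤ (⌊E / m⌋₊ + 1) ^ (d * L ^ 3) :=
    (card_le_freeCount_of_levelMatched hm h E F hF).trans (card_freeCount_le d m c L E)
  have h2 : (F.card : ℝ) ≤ ((⌊E / m⌋₊ : ℝ) + 1) ^ (d * L ^ 3) := by exact_mod_cast h1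
  have h3 : (⌊E / m⌋₊ : ℝ) ≤ E / m := Nat.floor_le (div_nonneg hE hm.le)
  have h4 : ((⌊E / m⌋₊ : ℝ) + 1) ^ (d * L ^ 3) ≤ (E / m + 1) ^ (d * L ^ 3) :=
    pow_le_pow_left₀ (by positivity) (by linarith) _
  exact h2.trans h4

/-- **LW-DOM-shaped statements carry a gap AND a finite density of states**: under a level matching of mass `m > 0` no level other than
those at energy `≥ m` exists below the vacuum — every finite family of levels with `rr i > e^{−m}` (strictly inside the gap) has at most ONE
member with `rr i ≠ 0`… stated in the counting currency: levels with `e^{−E} ≤ rr i` for `0 ≤ E < m` number at most `1` (the vacuum). -/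
theorem card_le_one_of_levelMatched_of_lt_mass {ι : Type} {rr : ι → ℝ} {d : ℕ} {m c : ℝ} {L : ℕ} (hm : 0 < m)
    (h : LevelMatched rr d m c L) {E : ℝ} (hEm : E < m) (F : Finset ι) (hF : ∀ i ∈ F, Real.exp (-E) ≤ rr i) :
    F.card ≤ 1 := by
  classical
  refine (card_le_freeCount_of_levelMatched hm h E F hF).trans ?_
  have hsub : freeCount d m c L E ⊆ {0} := by
    intro g hg
    unfold freeCount at hg
    rw [Finset.mem_filter] at hg
    rw [Finset.mem_singleton]
    by_contra hne
    have := mass_le_occupationEnergy d hm.le c L hne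
    linarith [hg.2]
  exact (Finset.card_le_card hsub).trans (by simp)

/-! ## The converse (Hall's marriage theorem): counting domination IS level matching -/

/-- Energy of an occupation in the free count is at most the count's energy. -/
theorem occupationEnergy_le_of_mem_freeCount {d : ℕ} {m c : ℝ} {L : ℕ} {E : ℝ} {g : Fin d × (Fin 3 → Fin L) → ℕ}
    (hg : g ∈ freeCount d m c L E) : occupationEnergy d m c L g ≤ E := by
  unfold freeCount at hg
  exact (Finset.mem_filter.1 hg).2

/-- The free count is monotone in the energy. -/
theorem freeCount_mono (d : ℕ) {m : ℝ} (hm : 0 < m) (c : ℝ) (L : ℕ) {E E' : ℝ} (hEE' : E ≤ E') :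
    freeCount d m c L E ⊆ freeCount d m c L E' :=
  fun _ hg => mem_freeCount d hm c L ((occupationEnergy_le_of_mem_freeCount hg).trans hEE')

/-- **Counting domination ⇒ level matching (Hall).**  For nonnegative levels `rr` (any mass parameter `m`): if for every energy `E` every finite
family of levels with `e^{−E} ≤ rr i` has at most `#freeCount(E)` members, then `rr` is level-matched into the free tower.  Proof: Hall's
marriage theorem (Mathlib's `Finset.all_card_le_biUnion_card_iff_exists_injective`, arbitrary index type) for the positive levels with the
NESTED targets `t i = freeCount(−log rr i)`; Hall's condition for a finite family `s` is the counting hypothesis at `E = max_{s} (−log rr i)`. -/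
theorem levelMatched_of_counting {ι : Type} {rr : ι → ℝ} {d : ℕ} {m c : ℝ} {L : ℕ} (hr : ∀ i, 0 ≤ rr i)
    (hcount : ∀ (E : ℝ) (F : Finset ι), (∀ i ∈ F, Real.exp (-E) ≤ rr i) → F.card ≤ (freeCount d m c L E).card) :
    LevelMatched rr d m c L := by
  classical
  -- positive levels and their energies
  let S := {i : ι // 0 < rr i}
  let En : S → ℝ := fun x => -Real.log (rr x.1)
  have hexpEn : ∀ x : S, Real.exp (-En x) = rr x.1 := by
    intro x
    show Real.exp (-(-Real.log (rr x.1))) = rr x.1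
    rw [neg_neg, Real.exp_log x.2]
  let t : S → Finset (Fin d × (Fin 3 → Fin L) → ℕ) := fun x => freeCount d m c L (En x)
  -- Hall's condition from the counting hypothesis at the maximal energy of the family
  have hHall : ∀ s : Finset S, s.card ≤ (s.biUnion t).card := by
    intro s
    rcases s.eq_empty_or_nonempty with hs | hs
    · simp [hs]
    obtain ⟨x₀, hx₀, hmax⟩ := Finset.exists_max_image s En hs
    have hF : ∀ i ∈ s.map (Function.Embedding.subtype _), Real.exp (-En x₀) ≤ rr i := by
      intro i hi
      obtain ⟨x, hx, rfl⟩ := Finset.mem_map.1 hi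
      have h1 : Real.exp (-En x₀) ≤ Real.exp (-En x) := Real.exp_le_exp.2 (by linarith [hmax x hx])
      exact h1.trans (hexpEn x).le
    have h1 := hcount (En x₀) (s.map (Function.Embedding.subtype _)) hF
    rw [Finset.card_map] at h1
    exact h1.trans (Finset.card_le_card (Finset.subset_biUnion_of_mem t hx₀))
  obtain ⟨f₀, hf₀inj, hf₀mem⟩ := (Finset.all_card_le_biUnion_card_iff_exists_injective t).1 hHall
  -- extend by the empty occupation off the positive levels
  refine ⟨fun i => if h : 0 < rr i then f₀ ⟨i, h⟩ else 0, ?_, ?_⟩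
  · intro i hi j hj hij
    have hi' : 0 < rr i := lt_of_le_of_ne (hr i) (Ne.symm hi)
    have hj' : 0 < rr j := lt_of_le_of_ne (hr j) (Ne.symm hj)
    simp only [dif_pos hi', dif_pos hj'] at hij
    have := hf₀inj hij
    exact congrArg Subtype.val this
  · intro i
    by_cases h : 0 < rr i
    · simp only [dif_pos h]
      have hE : occupationEnergy d m c L (f₀ ⟨i, h⟩) ≤ En ⟨i, h⟩ := occupationEnergy_le_of_mem_freeCount (hf₀mem ⟨i, h⟩)
      calc rr i = Real.exp (-En ⟨i, h⟩) := (hexpEn ⟨i, h⟩).symm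
        _ ≤ Real.exp (-(occupationEnergy d m c L (f₀ ⟨i, h⟩))) := Real.exp_le_exp.2 (by linarith)
    · simp only [dif_neg h]
      have : rr i = 0 := le_antisymm (not_lt.1 h) (hr i)
      rw [this]
      exact (Real.exp_pos _).le

/-- **Level matching ⟺ counting domination** (nonnegative levels, mass `m > 0`).  In particular, for a ratio datum of the cold torus
(`IsRatioDatum`, levels in `[0,1]`) the line statement «every level injectively dominated by the free tower» is LITERALLY the density-of-states
domination «for every `E`, #levels `≥ e^{−E}` ≤ #free occupations of energy `≤ E`» — the currency of the critic-typed DOS clause. -/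
theorem levelMatched_iff_counting {ι : Type} {rr : ι → ℝ} {d : ℕ} {m c : ℝ} {L : ℕ} (hm : 0 < m) (hr : ∀ i, 0 ≤ rr i) :
    LevelMatched rr d m c L ↔
      ∀ (E : ℝ) (F : Finset ι), (∀ i ∈ F, Real.exp (-E) ≤ rr i) → F.card ≤ (freeCount d m c L E).card :=
  ⟨fun h E F hF => card_le_freeCount_of_levelMatched hm h E F hF, levelMatched_of_counting hr⟩

end Summit.QuantumFields.YangMills.Cruxes.IR.LevelwiseDomination

end
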